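import Mathlib
import Summits.ValiantsHypothesis.ValiantsHypothesis.Theorems.ProofCarryingSymmetryRestorationQPESatKmax
import Summits.ValiantsHypothesis.ValiantsHypothesis.Theorems.ProofCarryingSymmetryRestorationQPESatRemoveBy
import Summits.ValiantsHypothesis.ValiantsHypothesis.Theorems.ProofCarryingSymmetryRestorationQPESatNvars

/-!
# Route ProofCarryingSymmetry — crux `RestorationQP`, line `registered`: e-saturated normal forms, part 2 —
factor lists, the pattern of a generic instance, root saturation

Support file for the crux item `stmt-ValiantsHypothesis-10343` (lead c5, cycle 5), continuing
`…ESatDefs` (definitions), `…ESatKmax`, `…ESatRemoveBy`, `…ESatNvars` (wave-1 stubs).  For a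
GENERIC ground distributivity instance `d` (`d.Generic`: each of `p, q, r` keeps a variable leaf):

* factor lists of normal forms (`NF.margs_spec`), left combs (`mulArgs_prodL`, `nf_prodL`,
  `olist_spec`);
* normal forms are determined modulo AC by (root factor classes, root constant)
  (`NF.acEq_of_mset_eq`, `NF.mset_eq_of_acEq`);
* the expansion `d.sig` is literally the sum `p·q + p·r` (`Generic.sig_eq`), its class is NOT in
  the pattern (`Generic.mk_sig_not_mem_pat`) and the pattern has at least two elements
  (`Generic.two_le_card_pat`) — by counting variable leaves (`nvars`);

Root saturation, the structure of peeling and the laws of the peeled product `emul d` are part 3 (`…ESatEMul`).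
Everything is elementary and proved; no named facts.
-/

-- single-problem summit: `Summit.ValiantsHypothesis.ValiantsHypothesis.…` is the namespace by design (D-0017)
set_option linter.dupNamespace false

noncomputable section

open scoped Classical

namespace Summit.ValiantsHypothesis.ValiantsHypothesis.Theorems

namespace ACStability

open Literature.Computability.AlgebraicComplexity ACClass

universe u v

variable {𝔽 : Type u} {X : Type v}

/-! ### Factor lists -/

/-- No flattened factor is itself a product. [folklore] -/
theorem headLabel_ne_mul_of_mem_mulArgs {F f : PIFormula 𝔽 X} (h : f ∈ mulArgs F) : headLabel f ≠ .mul := by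
  induction F with
  | var x => simp [mulArgs] at h; simp [h]
  | const c => simp [mulArgs] at h; simp [h]
  | add F G _ _ => simp [mulArgs] at h; simp [h]
  | mul F G ihF ihG =>
    simp only [mulArgs_mul, List.mem_append] at h
    exact h.elim ihF ihG

/-- The flattened factors of a left comb of non-products. [folklore] -/
theorem mulArgs_prodL {u : PIFormula 𝔽 X} {us : List (PIFormula 𝔽 X)}
    (h : ∀ f ∈ u :: us, headLabel f ≠ .mul) : mulArgs (prodL u us) = u :: us := by
  induction us using List.reverseRecOn with
  | nil => exact mulArgs_of_ne (h u (by simp))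
  | append_singleton ws w ih =>
    rw [prodL_append, prodL_nil, mulArgs_mul, ih fun f hf => h f (by simp at hf ⊢; tauto),
      mulArgs_of_ne (h w (by simp)), List.cons_append]

section Semiring

variable [CommSemiring 𝔽]

/-- A left comb of pure non-constant normal non-products is a pure normal form. [folklore] -/
theorem nf_prodL {u : PIFormula 𝔽 X} {us : List (PIFormula 𝔽 X)}
    (h : ∀ f ∈ u :: us, NF f ∧ constOf f = none ∧ headLabel f ≠ .mul) :
    NF (prodL u us) ∧ MPure (prodL u us) := by
  induction us using List.reverseRecOn with
  | nil =>
    obtain ⟨hn, hc, hl⟩ := h u (by simp)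
    refine ⟨hn, fun f hf => ?_⟩
    rw [prodL_nil, mulArgs_of_ne hl, List.mem_singleton] at hf
    rw [hf]; exact hc
  | append_singleton ws w ih =>
    obtain ⟨hn, hp⟩ := ih fun f hf => h f (by simp at hf ⊢; tauto)
    obtain ⟨hwn, hwc, hwl⟩ := h w (by simp)
    have hwp : MPure w := fun f hf => by
      rw [mulArgs_of_ne hwl, List.mem_singleton] at hf
      rw [hf]; exact hwc
    rw [prodL_append, prodL_nil]
    exact ⟨nf_mul_iff.2 ⟨⟨hp, Or.inr hwp⟩, hn, hwn⟩, mpure_mul_iff.2 ⟨hp, hwp⟩⟩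

/-- `olist` of a list of pure non-constant normal non-products is an admissible pure part. [folklore] -/
theorem olist_spec {l : List (PIFormula 𝔽 X)}
    (h : ∀ f ∈ l, NF f ∧ constOf f = none ∧ headLabel f ≠ .mul) :
    ∀ m, olist l = some m → NF m ∧ MPure m := by
  intro m hm
  cases l with
  | nil => simp at hm
  | cons u us =>
    simp only [olist_cons, Option.some.injEq] at hm
    subst hm
    exact nf_prodL h

omit [CommSemiring 𝔽] in
/-- The flattened factors of `olist`. [folklore] -/
theorem omulArgs_olist {l : List (PIFormula 𝔽 X)} (h : ∀ f ∈ l, headLabel f ≠ .mul) :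
    omulArgs (olist l) = l := by
  cases l with
  | nil => rfl
  | cons u us => exact mulArgs_prodL h

/-- **The root factors of a normal form** are normal, non-constant and not products. [folklore] -/
theorem NF.margs_spec {x : PIFormula 𝔽 X} (hx : NF x) :
    ∀ f ∈ margs x, NF f ∧ constOf f = none ∧ headLabel f ≠ .mul := by
  intro f hf
  rw [margs_def] at hf
  cases hm : (msplit x).1 with
  | none => rw [hm] at hf; simp at hf
  | some m =>
    rw [hm, omulArgs_some] at hf
    obtain ⟨hmn, hmp⟩ := hx.msplit_fst hm
    exact ⟨hmn.of_mem_subs (mem_subs_of_mem_mulArgs hf), hmp f hf, headLabel_ne_mul_of_mem_mulArgs hf⟩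

/-- The root factors of a formula with a pure part. [folklore] -/
theorem margs_of_msplit {x m : PIFormula 𝔽 X} (hm : (msplit x).1 = some m) : margs x = mulArgs m := by
  rw [margs_def, hm, omulArgs_some]

/-- A bare constant has no root factors. [folklore] -/
theorem margs_of_msplit_none {x : PIFormula 𝔽 X} (hm : (msplit x).1 = none) : margs x = [] := by
  rw [margs_def, hm, omulArgs_none]

/-- The root factors of a constant. [folklore] -/
@[simp] theorem margs_const (c : 𝔽) : margs (.const c : PIFormula 𝔽 X) = [] := rfl
/-- The root factor classes of a constant. [folklore] -/
@[simp] theorem mset_const (c : 𝔽) : mset (.const c : PIFormula 𝔽 X) = 0 := rfl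
/-- The root constant of a constant. [folklore] -/
@[simp] theorem mcst_const (c : 𝔽) : mcst (.const c : PIFormula 𝔽 X) = c := rfl

/-- No root factors means a bare constant (the pure part is absent). [folklore] -/
theorem msplit_fst_eq_none_of_margs {x : PIFormula 𝔽 X} (h : margs x = []) : (msplit x).1 = none := by
  cases hm : (msplit x).1 with
  | none => rfl
  | some m =>
    rw [margs_of_msplit hm] at h
    have := one_le_length_mulArgs m
    rw [h] at this
    exact absurd this (by simp)

/-- A normal form without root factors is the constant `mcst x`. [folklore] -/
theorem NF.eq_const_of_margs {x : PIFormula 𝔽 X} (hx : NF x) (h : margs x = []) : x = .const (mcst x) := by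
  have hm := msplit_fst_eq_none_of_margs h
  have := hx.mmk_msplit
  rw [hm] at this
  exact this.symm

/-- The class multiset of root factors is empty iff there are no root factors. [folklore] -/
theorem mset_eq_zero_iff {x : PIFormula 𝔽 X} : mset x = 0 ↔ margs x = [] := by
  rw [mset_def, Multiset.coe_eq_zero, List.map_eq_nil_iff]

/-- **A multiplicatively pure formula is its own root-factor comb**: `margs x = mulArgs x`,
`mcst x = 1`. [folklore] -/
theorem MPure.margs_eq {x : PIFormula 𝔽 X} (h : MPure x) : margs x = mulArgs x ∧ mcst x = 1 := by
  rw [margs_def, mcst_def, h.msplit_eq]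
  exact ⟨rfl, rfl⟩

/-- The root factors of a non-constant, non-product formula are the formula itself. [folklore] -/
theorem margs_of_ne {x : PIFormula 𝔽 X} (hc : constOf x = none) (hl : headLabel x ≠ .mul) :
    margs x = [x] ∧ mcst x = 1 := by
  have hp : MPure x := fun f hf => by
    rw [mulArgs_of_ne hl, List.mem_singleton] at hf
    rw [hf]; exact hc
  obtain ⟨h1, h2⟩ := hp.margs_eq
  exact ⟨h1.trans (mulArgs_of_ne hl), h2⟩

/-! ### Normal forms modulo AC are (root factor classes, root constant) -/

/-- **AC-equivalent normal forms have the same root factor classes and the same root constant.**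
[folklore] -/
theorem NF.mset_eq_of_acEq {x y : PIFormula 𝔽 X} (hx : NF x) (hy : NF y) (e : ACEq x y) :
    mset x = mset y ∧ mcst x = mcst y := by
  obtain ⟨hc, hr⟩ := msplit_rel hx hy e
  refine ⟨?_, hc⟩
  rw [mset_def, mset_def, margs_def, margs_def]
  revert hr
  cases (msplit x).1 with
  | none =>
    cases (msplit y).1 with
    | none => intro; rfl
    | some _ => intro h; exact h.elim
  | some m =>
    cases (msplit y).1 with
    | none => intro h; exact h.elim
    | some m' =>
      intro h
      exact h.mulArgs_map_mk_eq

/-- **Normal forms with the same root factor classes and root constant are AC-equivalent.**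
[folklore] -/
theorem NF.acEq_of_mset_eq {x y : PIFormula 𝔽 X} (hx : NF x) (hy : NF y)
    (h1 : mset x = mset y) (h2 : mcst x = mcst y) : ACEq x y := by
  rw [← hx.mmk_msplit, ← hy.mmk_msplit, ← mcst_def, ← mcst_def, h2]
  refine acEq_mmk ?_ _
  rw [mset_def, mset_def, margs_def, margs_def] at h1
  revert h1
  cases (msplit x).1 with
  | none =>
    cases (msplit y).1 with
    | none => intro; trivial
    | some m' =>
      intro h1
      have := one_le_length_mulArgs m'
      have h0 : (mulArgs m').length = 0 := by
        have := congrArg Multiset.card h1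
        simpa using this.symm
      omega
  | some m =>
    cases (msplit y).1 with
    | none =>
      intro h1
      have := one_le_length_mulArgs m
      have h0 : (mulArgs m).length = 0 := by
        have := congrArg Multiset.card h1
        simpa using this
      omega
    | some m' =>
      intro h1
      exact acEq_of_mulArgs_perm (Multiset.coe_eq_coe.1 h1)

end Semiring

/-! ### The expansion and the pattern of a generic instance -/

section Field

variable [Field 𝔽]

namespace DistData

variable (d : DistData 𝔽 X)

/-- `p` is a normal form. [folklore] -/
theorem nf_p : NF d.p := nf_cnorm _
/-- `q` is a normal form. [folklore] -/
theorem nf_q : NF d.q := nf_cnorm _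
/-- `r` is a normal form. [folklore] -/
theorem nf_r : NF d.r := nf_cnorm _
/-- `s` is a normal form. [folklore] -/
theorem nf_s : NF d.s := nf_sadd d.nf_q d.nf_r
/-- `sig` is a normal form. [folklore] -/
theorem nf_sig : NF d.sig := nf_sadd (nf_smul d.nf_p d.nf_q) (nf_smul d.nf_p d.nf_r)

/-- The leaf count of `s`. [folklore] -/
theorem nvars_s : nvars d.s = nvars d.q + nvars d.r := nvars_sadd _ _

/-- A normal form with a variable leaf has nonzero root constant. [folklore] -/
theorem mcst_ne_zero_of_nvars {x : PIFormula 𝔽 X} (hx : NF x) (h : 1 ≤ nvars x) : mcst x ≠ 0 := by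
  intro h0
  rw [mcst_def] at h0
  have := hx.eq_const_zero_of_msplit h0
  rw [this] at h
  simp at h

variable {d}

/-- For a generic instance the root constant `cP` of `p` is nonzero. [folklore] -/
theorem Generic.cP_ne_zero (hg : d.Generic) : d.cP ≠ 0 := mcst_ne_zero_of_nvars d.nf_p hg.1

/-- For a generic instance the constants of `p·q` and `p·r` do not vanish. [folklore] -/
theorem Generic.mcst_mul_ne_zero (hg : d.Generic) :
    (msplit d.p).2 * (msplit d.q).2 ≠ 0 ∧ (msplit d.p).2 * (msplit d.r).2 ≠ 0 :=
  ⟨mul_ne_zero (mcst_ne_zero_of_nvars d.nf_p hg.1) (mcst_ne_zero_of_nvars d.nf_q hg.2.1),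
    mul_ne_zero (mcst_ne_zero_of_nvars d.nf_p hg.1) (mcst_ne_zero_of_nvars d.nf_r hg.2.2)⟩

/-- The leaf count of the expansion: `2·nvars p + nvars q + nvars r`. [folklore] -/
theorem Generic.nvars_sig (hg : d.Generic) : nvars d.sig = 2 * nvars d.p + nvars d.q + nvars d.r := by
  rw [DistData.sig, nvars_sadd, nvars_smul_of_ne _ _ hg.mcst_mul_ne_zero.1,
    nvars_smul_of_ne _ _ hg.mcst_mul_ne_zero.2]
  ring

/-- The pure part of a normal form with a variable leaf is present. [folklore] -/
theorem msplit_fst_isSome_of_nvars {a : PIFormula 𝔽 X} (ha : NF a) (ha1 : 1 ≤ nvars a) :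
    ∃ m, (msplit a).1 = some m := by
  cases hm : (msplit a).1 with
  | some m => exact ⟨m, rfl⟩
  | none =>
    exfalso
    have := ha.mmk_msplit
    rw [hm] at this
    rw [← this] at ha1
    simp at ha1

/-- A smart product of normal forms with variable leaves and non-vanishing constants is a (possibly
scaled) genuine product: not a constant, and additively pure. [folklore] -/
theorem constOf_smul_of_ne {a b : PIFormula 𝔽 X} (ha : NF a) (hb : NF b)
    (h : (msplit a).2 * (msplit b).2 ≠ 0) (ha1 : 1 ≤ nvars a) (hb1 : 1 ≤ nvars b) :
    constOf (smul a b) = none ∧ APure (smul a b) := by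
  rw [smul_of_ne_zero h]
  obtain ⟨m, hm⟩ := msplit_fst_isSome_of_nvars ha ha1
  obtain ⟨m', hm'⟩ := msplit_fst_isSome_of_nvars hb hb1
  rw [hm, hm', mmerge_some_some]
  by_cases hc : (msplit a).2 * (msplit b).2 = 1
  · rw [hc, mmk_some_one]
    exact ⟨rfl, apure_mul _ _⟩
  · rw [mmk_some_of_ne _ hc]
    exact ⟨rfl, apure_mul _ _⟩

/-- **The expansion is literally the sum `p·q + p·r`** of the two smart products. [folklore] -/
theorem Generic.sig_eq (hg : d.Generic) : d.sig = .add (smul d.p d.q) (smul d.p d.r) := by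
  obtain ⟨h1, h2⟩ := hg.mcst_mul_ne_zero
  obtain ⟨-, hpq⟩ := constOf_smul_of_ne d.nf_p d.nf_q h1 hg.1 hg.2.1
  obtain ⟨-, hpr⟩ := constOf_smul_of_ne d.nf_p d.nf_r h2 hg.1 hg.2.2
  rw [DistData.sig, sadd_def, hpq.asplit_eq, hpr.asplit_eq]
  simp [amk]

/-- The expansion is a sum node, hence not a constant and not a product. [folklore] -/
theorem Generic.sig_shape (hg : d.Generic) : constOf d.sig = none ∧ headLabel d.sig ≠ .mul := by
  rw [hg.sig_eq]; simp

/-- The root factors of the expansion are the expansion itself. [folklore] -/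
theorem Generic.margs_sig (hg : d.Generic) : margs d.sig = [d.sig] ∧ mcst d.sig = 1 :=
  margs_of_ne hg.sig_shape.1 hg.sig_shape.2

/-- Every class of the pattern has fewer variable leaves than the expansion. [folklore] -/
theorem Generic.nvars_lt_of_mem_pat (hg : d.Generic) {c : ACClass 𝔽 X} (hc : c ∈ d.pat) :
    c.nvars < nvars d.sig := by
  rw [hg.nvars_sig]
  simp only [DistData.pat, Multiset.mem_coe, List.map_append, List.map_cons, List.map_nil,
    List.mem_append, List.mem_map, List.mem_singleton] at hc
  rcases hc with ⟨f, hf, rfl⟩ | rfl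
  · rw [nvars_mk]
    have := nvars_le_of_mem_margs hf
    have h1 := hg.1
    unfold DistData.patF at hf
    omega
  · rw [nvars_mk, nvars_s]
    have := hg.1
    omega

/-- **The class of the expansion is not in the pattern.** [folklore] -/
theorem Generic.mk_sig_not_mem_pat (hg : d.Generic) : ACClass.mk d.sig ∉ d.pat := fun h => by
  have h' := hg.nvars_lt_of_mem_pat h
  rw [nvars_mk] at h'
  exact lt_irrefl _ h'

/-- The pure factors of `p` are not empty. [folklore] -/
theorem Generic.patF_ne_nil (hg : d.Generic) : d.patF ≠ [] := by
  intro h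
  have := d.nf_p.eq_const_of_margs h
  have h1 := hg.1
  rw [this] at h1
  simp at h1

/-- **The pattern has at least two elements.** [folklore] -/
theorem Generic.two_le_card_pat (hg : d.Generic) : 2 ≤ Multiset.card d.pat := by
  unfold DistData.pat
  rw [Multiset.coe_card, List.length_map, List.length_append, List.length_singleton]
  have : d.patF.length ≠ 0 := fun h => hg.patF_ne_nil (List.eq_nil_of_length_eq_zero h)
  omega

/-- The leaf weight of the pattern is positive. [folklore] -/
theorem Generic.patVars_pos (hg : d.Generic) : 1 ≤ d.patVars := by
  unfold DistData.patVars; have := hg.1; omega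

/-- **The leaf weight of the pattern classes is `patVars`.** [folklore] -/
theorem pat_nvars_sum : (d.pat.map ACClass.nvars).sum = d.patVars := by
  unfold DistData.pat DistData.patVars DistData.patF
  rw [Multiset.map_coe, Multiset.sum_coe, List.map_map, List.map_append, List.sum_append]
  simp only [List.map_cons, List.map_nil, List.sum_cons, List.sum_nil, add_zero, Function.comp_def,
    nvars_mk]
  rw [← Function.comp_def, ← nvars_margs_sum d.p]
  rfl

end DistData

end Field

end ACStability

end Summit.ValiantsHypothesis.ValiantsHypothesis.Theorems

end
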